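/-
Copyright (c) 2026. All rights reserved.
Released under Apache 2.0 license as described in the file LICENSE.
Authors: abc-iut cell, F-lane seat abc-iut-f-187 (gen 3), KEY INST59L2.
-/
import Literature.NumberTheory.DiophantineGeometry.GenEllMellProofs
import HarnessLib

/-!
# [GenEll] Prop. 3.4 — INSTANCE FORMS of the fact-list row `prop34Ineq` (F-2759)

Mochizuki, *Arithmetic elliptic curves in general position*, Math. J. Okayama Univ. 52 (2010)
(`MochizukiGenEll2010`), Prop. 3.4 p. 17: for `ε ∈ ℝ_{>0}`,
`deg_∞ ≲ ht_∞ ≲ 12(1+ε)·ht^Falt ≲ (1+ε)·ht_∞` on `M_ell(Q̄)`.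

PROOF-ONLY file (no `def`, no `instance`, no notation); it imports — never edits — the statement
file `GenEllMell.lean` (the predicate `prop34Ineq ε`) and its proof companion `GenEllMellProofs.lean`
(`prop34Ineq_of_pos : 0 < ε → prop34Ineq ε`).

Bookkeeping context (cell abc-iut, frozen FACT-LIST row F-2759).  The row is a SCHEMA in `ε`: its
universal closure `∀ ε, prop34Ineq ε` is REFUTED in the tree (`not_forall_prop34Ineq`, at `ε = −1`,
`GenEllProp34IneqClosure.lean`), so the content of the row is its INSTANCE FORMS.  The instances the
tree actually consumes are exactly the values at which downstream proofs invoke `prop34Ineq_of_pos`: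
`ε = 1/6` (`GenEllFullGaloisProofs.lean`, `GenEllLCyclicHeightBound.lean`,
`GenEllLCyclicHeightBoundLinear.lean` — the printed "`12(1+ε) = 14`"), `ε = 1/5`
(`GenEllFullGaloisCorollaries.lean`) and `ε = 1` (`GenEllThm38.lean`, `GenEllThm38Holds.lean`).  This
file states each of them as a closed, hypothesis-free theorem whose conclusion head is the row's
declaration `Literature.NumberTheory.DiophantineGeometry.GenEll.prop34Ineq` (fully qualified), plus
the inhabited-`∃` form.  These are instances at GENUINE data (real numbers in the printed range), not
toy carriers.  Classical; no bearing on, and no side taken on, [IUTchIII] Cor. 3.12; an instance-form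
theorem about OUR typed statement is not a theorem about anything else in print.
-/

noncomputable section

namespace Literature.NumberTheory.DiophantineGeometry.GenEll

/-- **F-2759, INSTANCE at `ε = 1/6`** (the value `12(1+ε) = 14` used in the proof of [GenEll] Thm. 3.8
and Lem. 3.5 consumers `GenEllFullGaloisProofs` / `GenEllLCyclicHeightBound`):
`deg_∞ ≲ ht_∞ ≲ 14·ht^Falt ≲ (7/6)·ht_∞` on `M_ell(Q̄)`. [cite: MochizukiGenEll2010, Prop 3.4 p.17] -/
theorem prop34Ineq_one_sixth :
    Literature.NumberTheory.DiophantineGeometry.GenEll.prop34Ineq (1 / 6) :=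
  prop34Ineq_of_pos (by norm_num)

/-- **F-2759, INSTANCE at `ε = 1/5`** (the value consumed by `GenEllFullGaloisCorollaries`).
[cite: MochizukiGenEll2010, Prop 3.4 p.17] -/
theorem prop34Ineq_one_fifth :
    Literature.NumberTheory.DiophantineGeometry.GenEll.prop34Ineq (1 / 5) :=
  prop34Ineq_of_pos (by norm_num)

/-- **F-2759, INSTANCE at `ε = 1`** (the value consumed by `GenEllThm38` / `GenEllThm38Holds`):
`deg_∞ ≲ ht_∞ ≲ 24·ht^Falt ≲ 2·ht_∞` on `M_ell(Q̄)`. [cite: MochizukiGenEll2010, Prop 3.4 p.17] -/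
theorem prop34Ineq_one :
    Literature.NumberTheory.DiophantineGeometry.GenEll.prop34Ineq 1 :=
  prop34Ineq_of_pos one_pos

/-- **F-2759, INSTANCE at every positive natural-number-reciprocal `ε = 1/(n+1)`** — the whole family
of "small ε" instances as one closed statement. [cite: MochizukiGenEll2010, Prop 3.4 p.17] -/
theorem prop34Ineq_inv_natCast_succ (n : ℕ) :
    Literature.NumberTheory.DiophantineGeometry.GenEll.prop34Ineq (1 / ((n : ℝ) + 1)) :=
  prop34Ineq_of_pos (by positivity)

/-- **F-2759, `∃`-form**: the schema `prop34Ineq` is inhabited (at `ε = 1`).  Together with the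
tree's `not_forall_prop34Ineq` this records the row's exact status: a schema in `ε`, true on the
printed range `ε > 0`, false at `ε = −1`. [cite: MochizukiGenEll2010, Prop 3.4 p.17] -/
theorem exists_prop34Ineq :
    ∃ ε : ℝ, Literature.NumberTheory.DiophantineGeometry.GenEll.prop34Ineq ε :=
  ⟨1, prop34Ineq_one⟩

end Literature.NumberTheory.DiophantineGeometry.GenEll

end
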